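import Literature.NumberTheory.GaloisRepresentations.BrauerTower
import Mathlib.Topology.Algebra.ClopenNhdofOne
import HarnessLib

/-!
# Continuous `2`-cocycles on an intersection of closed subgroups extend to a finite stage

Topic `NumberTheory/GaloisRepresentations` (continuous cohomology of profinite groups); namespace
`Literature.NumberTheory.GaloisRepresentations`.  Definitions with bodies and theorems only
(no named fact, D-0026).

Let `G` be a profinite group (compact, Hausdorff, totally disconnected), `A` a FINITE discrete
`G`-module (`ρ : ContinuousRep G ℤ A`) and `S₀ ⊇ S₁ ⊇ S₂ ⊇ ⋯` a decreasing sequence of closed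
subgroups of `G` with intersection `S_∞ = ⨅ₖ Sₖ`.  Then

* `exists_resSub_eq_of_iInf` — **every class of `H²(S_∞, A)` is the restriction of a class of
  `H²(Sₖ, A)` for some `k`**; indeed (`extendCocycle`, `extendCocycle_apply_of_mem`) every continuous
  inhomogeneous `2`-cocycle of `S_∞` is, on the nose, the restriction of a continuous `2`-cocycle of
  some `Sₖ`;
* `subsingleton_two_iInf_of_forall_exists_resSub_eq_zero` — consequently, if every class of every
  `H²(Sₖ, A)` dies in some deeper `Sₖ'`, then `H²(S_∞, A) = 0`.

This is the surjectivity half of the continuity of cohomology,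
`H^q(⋂ Sₖ, A) = lim→ H^q(Sₖ, A)` (Serre, *Cohomologie galoisienne*, I §2.2 Prop. 8), in degree `2`
and for finite coefficients, which is what the computation of the cohomological dimension of the
inertia group of a local field consumes (`LocalFieldCdTwo`).

## Proof

Let `c : S_∞ × S_∞ → A` be a continuous `2`-cocycle.  By uniform local constancy on the compact group
`S_∞ × S_∞` (tube lemma `exists_nhds_one_forall_eq'`) and the finiteness of `A` there is an open normal
subgroup `W ⊴ G` acting trivially on `A` such that `c(s, t)` only depends on the cosets `sW`, `tW`
(`exists_openNormalSubgroup_adapted`).  The open set `S_∞ · W` contains `S_∞ = ⋂ Sₖ`, so by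
compactness it contains some `Sₖ` (`exists_coe_subset_mul`).  For `σ ∈ Sₖ` pick `s(σ) ∈ S_∞` with
`σ ∈ s(σ) W`; then `(σ, τ) ↦ c(s(σ), s(τ))` does not depend on the choices (normality of `W`), is
locally constant, satisfies the cocycle identity (the action of `σ` on `A` is that of `s(σ)`), and
restricts to `c` on `S_∞ × S_∞` (`extendCocycle`).

## References

* J.-P. Serre, *Cohomologie galoisienne*, LNM 5 / *Galois Cohomology* (1997), I §2.2 Prop. 8
  (`H^q(lim← Gᵢ, lim→ Aᵢ) = lim→ H^q(Gᵢ, Aᵢ)`), I §2.3. [SerreGaloisCohomology1997]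
* S. S. Shatz, *Profinite groups, arithmetic, and geometry* (1972), Ch. II §2 (continuity of
  cohomology). [Shatz1972]
-/

noncomputable section

open scoped Pointwise
open CategoryTheory Topology Filter

namespace Literature.NumberTheory.GaloisRepresentations

open _root_.TopRep _root_.ContRepresentation _root_.ContinuousCohomology

universe u

/-! ### Uniform local constancy -/

/-- **Uniform local constancy** (tube lemma): for a compact space `X`, a topological group `P` and a
jointly continuous `f : X × P → M` into a discrete space there is a neighbourhood `V` of `1` with
`f(x, v) = f(x, 1)` for all `x` and all `v ∈ V`.  (Same statement and proof as
`Literature.NumberTheory.EllipticCurves.exists_nhds_one_forall_eq`, repeated here to keep the import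
graph of this topic inside `GaloisRepresentations`.) [folklore] -/
theorem exists_nhds_one_forall_eq' {X P M : Type*} [TopologicalSpace X] [CompactSpace X] [Group P]
    [TopologicalSpace P] [TopologicalSpace M] [DiscreteTopology M] (f : X → P → M)
    (hf : Continuous (Function.uncurry f)) :
    ∃ V ∈ 𝓝 (1 : P), ∀ x : X, ∀ v ∈ V, f x v = f x 1 := by
  set T : Set (X × P) := {q | f q.1 q.2 = f q.1 1} with hT
  have hTopen : IsOpen T := by
    have h1 : Continuous fun q : X × P => (f q.1 q.2, f q.1 1) :=
      hf.prodMk (hf.comp (continuous_fst.prodMk continuous_const))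
    exact (isOpen_discrete (Set.diagonal M)).preimage h1
  obtain ⟨u, w, -, hw, huniv, h1w, huw⟩ :=
    generalized_tube_lemma (isCompact_univ (X := X)) (isCompact_singleton (x := (1 : P))) hTopen
      (fun q hq => by
        obtain ⟨-, hq2⟩ := hq
        rw [Set.mem_singleton_iff] at hq2
        show f q.1 q.2 = f q.1 1
        rw [hq2])
  exact ⟨w, hw.mem_nhds (h1w rfl), fun x v hv =>
    show (x, v) ∈ T from huw (Set.mk_mem_prod (huniv (Set.mem_univ x)) hv)⟩

section Profinite

variable {G : Type u} [Group G] [TopologicalSpace G] [IsTopologicalGroup G] [CompactSpace G]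
  [T2Space G] [TotallyDisconnectedSpace G]
variable {A : Type u} [AddCommGroup A] [TopologicalSpace A] [DiscreteTopology A]
variable (ρ : ContinuousRep G ℤ A)

attribute [local instance] compactSpace_of_isClosed_subgroup

/-! ### Cocycles adapted to an open normal subgroup -/

/-- A `2`-cocycle `c` of a subgroup `S` is **adapted** to the (open normal) subgroup `W` if `W` acts
trivially on `A` and `c(s, t)` only depends on the cosets `sW`, `tW`. [folklore] -/
structure IsAdapted (S : Subgroup G) (W : Subgroup G)
    (c : contTwoCocycles (ρ.restrict (subgroupIncl S)).toTopRep) : Prop where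
  /-- `W` acts trivially. -/
  triv : ∀ w ∈ W, ∀ a : A, ρ w a = a
  /-- `c` is constant on `W`-cosets in both arguments. -/
  const : ∀ s t s' t' : S, ((s : G)⁻¹ * s' ∈ W) → ((t : G)⁻¹ * t' ∈ W) → c.1 (s, t) = c.1 (s', t')

omit [T2Space G] in
/-- **Every continuous `2`-cocycle of a closed subgroup with values in a finite module is adapted to
some open normal subgroup of `G`** (uniform local constancy on the compact group `S × S`, finiteness
of `A`, and the basis of open normal subgroups of the profinite group `G`).
[cite: SerreGaloisCohomology1997, I §2.2 Prop. 8 (proof)] -/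
theorem exists_openNormalSubgroup_adapted [Finite A] (S : Subgroup G) [IsClosed (S : Set G)]
    (c : contTwoCocycles (ρ.restrict (subgroupIncl S)).toTopRep) :
    ∃ W : OpenNormalSubgroup G, IsAdapted ρ S W c := by
  classical
  -- the kernel of the action is a neighbourhood of `1`
  have hU₀ : (⋂ a : A, {g : G | ρ g a = a}) ∈ 𝓝 (1 : G) :=
    (Filter.iInter_mem).2 fun a => ρ.setOf_apply_eq_mem_nhds_one a
  -- uniform local constancy of `c` on `S × S`
  obtain ⟨V, hV, hVc⟩ := exists_nhds_one_forall_eq' (X := S × S) (P := S × S)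
    (fun z v => c.1 (z * v)) (c.1.continuous.comp continuous_mul)
  obtain ⟨V₁, hV₁, V₂, hV₂, hV₁₂⟩ := mem_nhds_prod_iff.1 hV
  obtain ⟨U₁, hU₁, hU₁V⟩ := (mem_nhds_subtype _ (1 : S) (V₁ ∩ V₂)).1 (inter_mem hV₁ hV₂)
  -- an open normal subgroup inside both
  have h1 : (1 : G) ∈ interior ((⋂ a : A, {g : G | ρ g a = a}) ∩ U₁) :=
    mem_interior_iff_mem_nhds.2 (inter_mem hU₀ hU₁)
  obtain ⟨W, hW⟩ := ProfiniteGrp.exist_openNormalSubgroup_sub_open_nhds_of_one isOpen_interior h1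
  have hW' : (W : Set G) ⊆ (⋂ a : A, {g : G | ρ g a = a}) ∩ U₁ := hW.trans interior_subset
  refine ⟨W, ⟨fun w hw a => ?_, fun s t s' t' hs ht => ?_⟩⟩
  · exact Set.mem_iInter.1 (hW' hw).1 a
  · -- `(s', t') = (s, t) * (s⁻¹ s', t⁻¹ t')` with the second factor in `V₁ × V₂ ⊆ V`
    have hs₁ : (⟨(s : G)⁻¹ * s', S.mul_mem (S.inv_mem s.2) s'.2⟩ : S) ∈ V₁ ∩ V₂ :=
      hU₁V (show ((⟨(s : G)⁻¹ * s', _⟩ : S) : G) ∈ U₁ from (hW' hs).2)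
    have ht₁ : (⟨(t : G)⁻¹ * t', S.mul_mem (S.inv_mem t.2) t'.2⟩ : S) ∈ V₁ ∩ V₂ :=
      hU₁V (show ((⟨(t : G)⁻¹ * t', _⟩ : S) : G) ∈ U₁ from (hW' ht).2)
    have hmem : ((⟨(s : G)⁻¹ * s', S.mul_mem (S.inv_mem s.2) s'.2⟩ : S),
        (⟨(t : G)⁻¹ * t', S.mul_mem (S.inv_mem t.2) t'.2⟩ : S)) ∈ V :=
      hV₁₂ (Set.mk_mem_prod hs₁.1 ht₁.2)
    have h := hVc (s, t) _ hmem
    rw [mul_one] at h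
    have hst : (s, t) * ((⟨(s : G)⁻¹ * s', S.mul_mem (S.inv_mem s.2) s'.2⟩ : S),
        (⟨(t : G)⁻¹ * t', S.mul_mem (S.inv_mem t.2) t'.2⟩ : S)) = (s', t') := by
      ext
      · change (s : G) * ((s : G)⁻¹ * s') = s'
        rw [mul_inv_cancel_left]
      · change (t : G) * ((t : G)⁻¹ * t') = t'
        rw [mul_inv_cancel_left]
    rw [hst] at h
    exact h.symm

/-! ### Extension of an adapted cocycle from `S_∞` to `T ⊆ S_∞ W` -/

section Extend

variable {ρ}
variable {S T : Subgroup G} {W : Subgroup G} [W.Normal]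

variable {c : contTwoCocycles (ρ.restrict (subgroupIncl S)).toTopRep}

omit [TopologicalSpace G] [IsTopologicalGroup G] [CompactSpace G] [T2Space G]
  [TotallyDisconnectedSpace G] [W.Normal] in
/-- Two `S`-representatives of the same `W`-coset differ by an element of `W`. [folklore] -/
theorem inv_mul_mem_of_reps {σ : G} {s s' : G} (hs : s⁻¹ * σ ∈ W) (hs' : s'⁻¹ * σ ∈ W) :
    s⁻¹ * s' ∈ W := by
  have h : s⁻¹ * s' = (s⁻¹ * σ) * (s'⁻¹ * σ)⁻¹ := by group
  rw [h]
  exact W.mul_mem hs (W.inv_mem hs')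

omit [TopologicalSpace G] [IsTopologicalGroup G] [CompactSpace G] [T2Space G]
  [TotallyDisconnectedSpace G] in
/-- Representatives multiply: if `s⁻¹ σ ∈ W` and `t⁻¹ τ ∈ W` then `(st)⁻¹ (στ) ∈ W` (`W` normal).
[folklore] -/
theorem mul_rep_mem {σ τ s t : G} (hs : s⁻¹ * σ ∈ W) (ht : t⁻¹ * τ ∈ W) :
    (s * t)⁻¹ * (σ * τ) ∈ W := by
  have h : (s * t)⁻¹ * (σ * τ) = (t⁻¹ * (s⁻¹ * σ) * t) * (t⁻¹ * τ) := by group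
  rw [h]
  refine W.mul_mem ?_ ht
  have := Subgroup.Normal.conj_mem inferInstance _ hs t⁻¹
  rwa [inv_inv] at this

omit [IsTopologicalGroup G] [CompactSpace G] [T2Space G] [TotallyDisconnectedSpace G] [W.Normal] in
/-- The action of `σ ∈ T` on `A` is that of its representative `s(σ)` (`W` acts trivially).
[folklore] -/
theorem apply_eq_apply_rep (hc : IsAdapted ρ S W c) {σ s : G} (hs : s⁻¹ * σ ∈ W) (a : A) :
    ρ σ a = ρ s a := by
  have h : σ = s * (s⁻¹ * σ) := by rw [mul_inv_cancel_left]
  conv_lhs => rw [h, map_mul, Module.End.mul_apply, hc.triv _ hs a]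

variable (hST : S ≤ T) (hT : (T : Set G) ⊆ (S : Set G) * (W : Set G))

include hT

omit [TopologicalSpace G] [IsTopologicalGroup G] [CompactSpace G] [T2Space G]
  [TotallyDisconnectedSpace G] [W.Normal] in
/-- Every `σ ∈ T ⊆ S · W` has an `S`-representative `s` with `s⁻¹ σ ∈ W`. [folklore] -/
theorem exists_rep (σ : T) : ∃ s : S, ((s : G))⁻¹ * σ ∈ W := by
  obtain ⟨s, hs, w, hw, hsw⟩ := Set.mem_mul.1 (hT σ.2)
  refine ⟨⟨s, hs⟩, ?_⟩
  change s⁻¹ * (σ : G) ∈ W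
  rw [← hsw, inv_mul_cancel_left]
  exact hw

/-- A chosen `S`-representative `s(σ)` of `σ ∈ T ⊆ S · W`. [folklore] -/
def cosetRep (σ : T) : S := (exists_rep hT σ).choose

omit [TopologicalSpace G] [IsTopologicalGroup G] [CompactSpace G] [T2Space G]
  [TotallyDisconnectedSpace G] [W.Normal] in
/-- `s(σ)⁻¹ σ ∈ W`. [folklore] -/
theorem cosetRep_inv_mul_mem (σ : T) : ((cosetRep hT σ : S) : G)⁻¹ * σ ∈ W :=
  (exists_rep hT σ).choose_spec

/-- The extended function `(σ, τ) ↦ c(s(σ), s(τ))`. [folklore] -/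
def extendFun (c : contTwoCocycles (ρ.restrict (subgroupIncl S)).toTopRep) (q : T × T) : A :=
  c.1 (cosetRep hT q.1, cosetRep hT q.2)

omit [IsTopologicalGroup G] [CompactSpace G] [T2Space G] [TotallyDisconnectedSpace G] [W.Normal] in
/-- **Independence of the representatives**: `extendFun (σ, τ) = c(s, t)` for ANY `s, t ∈ S` with
`s⁻¹ σ, t⁻¹ τ ∈ W`, when `c` is adapted to `W`. [folklore] -/
theorem extendFun_eq (hc : IsAdapted ρ S W c) (σ τ : T) (s t : S)
    (hs : ((s : G))⁻¹ * σ ∈ W) (ht : ((t : G))⁻¹ * τ ∈ W) :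
    extendFun hT c (σ, τ) = c.1 (s, t) := by
  unfold extendFun
  exact hc.const _ _ _ _ (inv_mul_mem_of_reps (cosetRep_inv_mul_mem hT σ) hs)
    (inv_mul_mem_of_reps (cosetRep_inv_mul_mem hT τ) ht)

omit [CompactSpace G] [T2Space G] [TotallyDisconnectedSpace G] [W.Normal] in
/-- The extended function is continuous (it is constant on the open sets
`{σ' | σ⁻¹σ' ∈ W} × {τ' | τ⁻¹τ' ∈ W}`). [folklore] -/
theorem continuous_extendFun (hWo : IsOpen (W : Set G)) (hc : IsAdapted ρ S W c) :
    Continuous (extendFun hT c) := by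
  refine continuous_discrete_rng.2 fun a => isOpen_iff_mem_nhds.2 fun q hq => ?_
  -- the open neighbourhood `{q' | q.1⁻¹ q'.1 ∈ W ∧ q.2⁻¹ q'.2 ∈ W}` of `q`
  have hO : IsOpen {q' : T × T | ((q.1 : T) : G)⁻¹ * q'.1 ∈ W ∧ ((q.2 : T) : G)⁻¹ * q'.2 ∈ W} := by
    refine IsOpen.inter ?_ ?_
    · exact hWo.preimage ((continuous_const.mul (continuous_subtype_val.comp continuous_fst)))
    · exact hWo.preimage ((continuous_const.mul (continuous_subtype_val.comp continuous_snd)))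
  refine Filter.mem_of_superset (hO.mem_nhds ⟨by simp, by simp⟩) fun q' hq' => ?_
  rw [Set.mem_preimage, Set.mem_singleton_iff] at hq ⊢
  rw [← hq]
  -- both are `c(s(q.1), s(q.2))`
  have h1 : ((cosetRep hT q.1 : S) : G)⁻¹ * q'.1 ∈ W := by
    have h := W.mul_mem (cosetRep_inv_mul_mem hT q.1) hq'.1
    rwa [mul_assoc, mul_inv_cancel_left] at h
  have h2 : ((cosetRep hT q.2 : S) : G)⁻¹ * q'.2 ∈ W := by
    have h := W.mul_mem (cosetRep_inv_mul_mem hT q.2) hq'.2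
    rwa [mul_assoc, mul_inv_cancel_left] at h
  exact extendFun_eq hT hc q'.1 q'.2 _ _ h1 h2

/-- **The extended cocycle** on `T`: `(σ, τ) ↦ c(s(σ), s(τ))` is a continuous `2`-cocycle of `T`.
[cite: SerreGaloisCohomology1997, I §2.2 Prop. 8 (proof)] -/
def extendCocycle (hWo : IsOpen (W : Set G)) (hc : IsAdapted ρ S W c) :
    contTwoCocycles (ρ.restrict (subgroupIncl T)).toTopRep :=
  ⟨⟨extendFun hT c, continuous_extendFun hT hWo hc⟩, fun σ τ υ => by
    -- representatives
    set s : S := cosetRep hT σ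
    set t : S := cosetRep hT τ
    set r : S := cosetRep hT υ
    have hs := cosetRep_inv_mul_mem hT σ
    have ht := cosetRep_inv_mul_mem hT τ
    have hr := cosetRep_inv_mul_mem hT υ
    have hτυ : ((t * r : S) : G)⁻¹ * ((τ * υ : T) : G) ∈ W := mul_rep_mem ht hr
    have hστ : ((s * t : S) : G)⁻¹ * ((σ * τ : T) : G) ∈ W := mul_rep_mem hs ht
    change (ρ.restrict (subgroupIncl T)).toTopRep.ρ σ (extendFun hT c (τ, υ)) +
        extendFun hT c (σ, τ * υ) = extendFun hT c (σ * τ, υ) + extendFun hT c (σ, τ)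
    rw [extendFun_eq hT hc τ υ t r ht hr, extendFun_eq hT hc σ (τ * υ) s (t * r) hs hτυ,
      extendFun_eq hT hc (σ * τ) υ (s * t) r hστ hr, extendFun_eq hT hc σ τ s t hs ht,
      ContinuousRep.toTopRep_ρ_apply, ContinuousRep.restrict_apply, subgroupIncl_apply,
      apply_eq_apply_rep hc hs]
    have h := c.2 s t r
    rw [ContinuousRep.toTopRep_ρ_apply, ContinuousRep.restrict_apply, subgroupIncl_apply] at h
    exact h⟩

omit [CompactSpace G] [T2Space G] [TotallyDisconnectedSpace G] in
/-- Unfolding `extendCocycle`. [folklore] -/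
@[simp] theorem extendCocycle_apply (hWo : IsOpen (W : Set G)) (hc : IsAdapted ρ S W c) (σ τ : T) :
    (extendCocycle hT hWo hc).1 (σ, τ) = extendFun hT c (σ, τ) := rfl

omit [CompactSpace G] [T2Space G] [TotallyDisconnectedSpace G] in
/-- **The extended cocycle restricts to `c` on `S`.** [folklore] -/
theorem extendCocycle_apply_of_mem (hWo : IsOpen (W : Set G)) (hc : IsAdapted ρ S W c) (s t : S) :
    (extendCocycle hT hWo hc).1 (Subgroup.inclusion hST s, Subgroup.inclusion hST t) = c.1 (s, t) := by
  rw [extendCocycle_apply]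
  exact extendFun_eq hT hc _ _ s t (by simp) (by simp)

omit [TotallyDisconnectedSpace G] in
/-- **On classes: `res_{T → S} [extendCocycle c] = [c]`.** [cite: SerreGaloisCohomology1997, I §2.2 Prop. 8] -/
theorem resSub_twoCocycleClass_extendCocycle [IsClosed (S : Set G)] [IsClosed (T : Set G)]
    (hWo : IsOpen (W : Set G)) (hc : IsAdapted ρ S W c) :
    resSub ρ hST 2 (twoCocycleClass _ (extendCocycle hT hWo hc)) = twoCocycleClass _ c := by
  rw [resSub, map_twoCocycleClass]
  congr 1
  refine Subtype.ext (ContinuousMap.ext fun q => ?_)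
  obtain ⟨s, t⟩ := q
  rw [contTwoCocycles.pullback_apply, resSubMod_hom_apply]
  exact extendCocycle_apply_of_mem hST hT hWo hc s t

end Extend

/-! ### Compactness: some `Sₖ` lies in `S_∞ W` -/

omit [TotallyDisconnectedSpace G] [T2Space G] in
/-- **Compactness step**: for a decreasing sequence of closed subgroups `Sₖ` and an open subgroup
`W`, some `Sₖ` is contained in the open set `(⨅ Sₖ) · W`. [folklore] -/
theorem exists_coe_subset_mul (S : ℕ → Subgroup G) (hS : Antitone S)
    (hcl : ∀ k, IsClosed ((S k : Subgroup G) : Set G)) (W : Subgroup G) (hWo : IsOpen (W : Set G)) :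
    ∃ k, ((S k : Subgroup G) : Set G) ⊆ ((⨅ k, S k : Subgroup G) : Set G) * (W : Set G) := by
  set O : Set G := ((⨅ k, S k : Subgroup G) : Set G) * (W : Set G) with hO
  have hOo : IsOpen O := hWo.mul_left
  have hsub : ((⨅ k, S k : Subgroup G) : Set G) ⊆ O := fun x hx =>
    Set.mem_mul.2 ⟨x, hx, 1, W.one_mem, mul_one x⟩
  -- the compact set `Oᶜ` misses `⋂ Sₖ`
  have hcpt : IsCompact Oᶜ := hOo.isClosed_compl.isCompact
  have hempty : Oᶜ ∩ ⋂ k, ((S k : Subgroup G) : Set G) = ∅ := by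
    rw [← Subgroup.coe_iInf, Set.eq_empty_iff_forall_notMem]
    rintro x ⟨hx1, hx2⟩
    exact hx1 (hsub hx2)
  have hdir : Directed (· ⊇ ·) fun k => ((S k : Subgroup G) : Set G) := by
    refine fun i j => ⟨max i j, ?_, ?_⟩
    · exact fun x hx => hS (le_max_left i j) hx
    · exact fun x hx => hS (le_max_right i j) hx
  obtain ⟨k, hk⟩ := hcpt.elim_directed_family_closed _ hcl hempty hdir
  refine ⟨k, fun x hx => ?_⟩
  by_contra hxO
  exact (Set.eq_empty_iff_forall_notMem.1 hk) x ⟨hxO, hx⟩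

/-! ### The extension theorem and the vanishing criterion -/

omit [T2Space G] in
/-- **Every continuous `2`-cocycle of `S_∞ = ⨅ Sₖ` with finite coefficients is the restriction of a
continuous `2`-cocycle of some `Sₖ`** (decreasing sequence of closed subgroups of a profinite group).
[cite: SerreGaloisCohomology1997, I §2.2 Prop. 8] -/
theorem exists_cocycle_extension_of_iInf [Finite A] (S : ℕ → Subgroup G) (hS : Antitone S)
    (hcl : ∀ k, IsClosed ((S k : Subgroup G) : Set G))
    (c : contTwoCocycles (ρ.restrict (subgroupIncl (⨅ k, S k))).toTopRep) :
    ∃ (k : ℕ) (c' : contTwoCocycles (ρ.restrict (subgroupIncl (S k))).toTopRep),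
      ∀ s t : (⨅ k, S k : Subgroup G),
        c'.1 (Subgroup.inclusion (iInf_le S k) s, Subgroup.inclusion (iInf_le S k) t) = c.1 (s, t) := by
  haveI : IsClosed (((⨅ k, S k : Subgroup G)) : Set G) := by
    rw [Subgroup.coe_iInf]
    exact isClosed_iInter hcl
  obtain ⟨W, hc⟩ := exists_openNormalSubgroup_adapted ρ (⨅ k, S k) c
  obtain ⟨k, hk⟩ := exists_coe_subset_mul S hS hcl W.toSubgroup W.isOpen
  exact ⟨k, extendCocycle (W := W.toSubgroup) hk W.isOpen hc,
    extendCocycle_apply_of_mem (iInf_le S k) hk W.isOpen hc⟩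

/-- **Every class of `H²(⨅ Sₖ, A)` is restricted from some `H²(Sₖ, A)`** (finite `A`, decreasing
closed `Sₖ` in a profinite group): the surjectivity of `lim→ H²(Sₖ, A) → H²(⋂ Sₖ, A)`.
[cite: SerreGaloisCohomology1997, I §2.2 Prop. 8] [cite: Shatz1972, Ch. II §2] -/
theorem exists_resSub_eq_of_iInf [Finite A] (S : ℕ → Subgroup G) (hS : Antitone S)
    (hcl : ∀ k, IsClosed ((S k : Subgroup G) : Set G))
    (x : continuousCohomology 2 (ρ.restrict (subgroupIncl (⨅ k, S k))).toTopRep) :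
    ∃ (k : ℕ) (y : continuousCohomology 2 (ρ.restrict (subgroupIncl (S k))).toTopRep),
      @resSub G _ _ _ A _ _ _ ρ _ _ (iInf_le S k) 2 y = x := by
  haveI : IsClosed (((⨅ k, S k : Subgroup G)) : Set G) := by
    rw [Subgroup.coe_iInf]
    exact isClosed_iInter hcl
  haveI : ∀ k, IsClosed ((S k : Subgroup G) : Set G) := hcl
  obtain ⟨c, rfl⟩ := twoCocycleClass_surjective _ x
  obtain ⟨W, hc⟩ := exists_openNormalSubgroup_adapted ρ (⨅ k, S k) c
  obtain ⟨k, hk⟩ := exists_coe_subset_mul S hS hcl W.toSubgroup W.isOpen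
  exact ⟨k, twoCocycleClass _ (extendCocycle (W := W.toSubgroup) hk W.isOpen hc),
    resSub_twoCocycleClass_extendCocycle (iInf_le S k) hk W.isOpen hc⟩

/-- **Vanishing criterion for `H²` of an intersection**: if every class of every `H²(Sₖ, A)` dies in
some deeper `Sₖ'` (`k ≤ k'`), then `H²(⨅ Sₖ, A) = 0` (finite `A`, decreasing closed `Sₖ` in a profinite
group). [cite: SerreGaloisCohomology1997, I §2.2 Prop. 8 and Cor. 1] -/
theorem subsingleton_two_iInf_of_forall_exists_resSub_eq_zero [Finite A] (S : ℕ → Subgroup G)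
    (hS : Antitone S) (hcl : ∀ k, IsClosed ((S k : Subgroup G) : Set G))
    (hkill : ∀ (k : ℕ) (y : continuousCohomology 2 (ρ.restrict (subgroupIncl (S k))).toTopRep),
      ∃ (k' : ℕ) (hkk' : k ≤ k'), resSub ρ (hS hkk') 2 y = 0) :
    Subsingleton (continuousCohomology 2 (ρ.restrict (subgroupIncl (⨅ k, S k))).toTopRep) := by
  refine subsingleton_of_forall_eq 0 fun x => ?_
  obtain ⟨k, y, rfl⟩ := exists_resSub_eq_of_iInf ρ S hS hcl x
  obtain ⟨k', hkk', hy⟩ := hkill k y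
  rw [← resSub_resSub ρ (iInf_le S k') (hS hkk') 2 y, hy, map_zero]

end Profinite

end Literature.NumberTheory.GaloisRepresentations

end
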